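import Literature.NumberTheory.LFunctions.MoebiusLogHarmonicSum
import HarnessLib

/-!
# `∑_{n ≤ y} μ(n) log²(y/n) / n = 2 log y + O(1)` (the second logarithmic Riesz mean of `μ(n)/n`)

Topic `Literature/NumberTheory/LFunctions`. Everything in this file is PROVED, as a corollary of three
results of the tree: `m(t) = ∑_{n ≤ t} μ(n)/n ≪ exp(−c√log t)`
(`Literature.NumberTheory.LFunctions.abs_sum_moebius_div_le_exp_neg_sqrt_log`, Montgomery–Vaughan
Thm. 6.9), `∫_1^∞ m(t) dt/t = 1` and its tail
(`Literature.NumberTheory.Sieve.GreenTao2008.integral_moebiusHarmonic_div_eq_one`,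
`integral_Ioi_abs_moebiusHarmonic_div_le`, file `GreenTao2008MoebiusLogSum.lean`), through Abel
summation:

* `moebiusLogSqSum y = R₂(y) := ∑_{1 ≤ n ≤ y} μ(n)/n · log²(y/n)`;
* `moebiusLogSqSum_eq_integral` — `R₂(y) = 2 ∫_1^y (log y − log t) m(t) dt/t` (`y ≥ 1`);
* `integrableOn_log_mul_moebiusHarmonic_div` — `t ↦ log t · m(t)/t` is integrable on `(1, ∞)`;
* `exists_abs_moebiusLogSqSum_sub_two_mul_log_le` — there is `K` with `|R₂(y) − 2 log y| ≤ K` for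
  every `y ≥ 1` (from `R₂(y) − 2 log y = −2∫_1^y m(t) log t dt/t − 2 log y ∫_y^∞ m(t) dt/t`).

This is the `k = 0`, `P = X²` case of the Möbius sums behind the main term of the
Kowalski–Michel–VanderKam first mollified moment (J. reine angew. Math. 526 (2000), §4 (16)–(20)):
with the multiplicative weight `ψ(m)⁻¹` removed by a convergent Dirichlet convolution, the diagonal
sum `∑_{m ≤ M} μ(m)/(mψ(m)) · (log(M/m)/log M)²` is `(∑_d h(d)/d · R₂(M/d))/log² M`, so the present
file is the prime-number-theorem input of `KMV2000.MollifierMainTermAsymp (X^2)` (cell landau-siegel,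
route `PrimeLevelFamEdge`, crux K_B, registered stub `stub_mollifierMainTermXSq`). Classical
(Selberg 1949 / Tatuzawa–Iseki 1951 prove `R₂(y) = 2 log y + O(1)` elementarily; here it is read off
the de la Vallée-Poussin rate already in the tree).

## References

* G. H. Hardy, E. M. Wright, *An Introduction to the Theory of Numbers*, 6th ed., OUP 2008, §22.14,
  (22.14.10)–(22.14.12) (`Σ_{d≤x} μ(d)/d·{log²(x/d) − γ²} = 2 log x + O(1)`, inside the proof of
  Selberg's theorem, Thm. 430) and §22.5 (22.5.2) (partial summation).
  [cite: HardyWright2008, §22.14 (22.14.10)–(22.14.12)] [held: book:hardy2008-introduction-theory-numbers p0278–p0279]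
* H. L. Montgomery, R. C. Vaughan, *Multiplicative Number Theory I*, CUP 2007, §6.2 Thm. 6.9 and
  §8.1 (8.6)–(8.8). [cite: MontgomeryVaughan2007, §8.1]
* E. Kowalski, P. Michel, J. VanderKam, J. reine angew. Math. 526 (2000) 1–34, §4 (16)–(20).
  [cite: KowalskiMichelVanderKam2000, §4 (16)–(20)]
-/

noncomputable section

open Real MeasureTheory Set Filter Topology Finset
open scoped ArithmeticFunction.Moebius

namespace Literature.NumberTheory.LFunctions

namespace MoebiusLogSum

open Literature.NumberTheory.Sieve.GreenTao2008

/-! ### The sum `R₂` -/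

/-- The second logarithmic Riesz mean `R₂(y) = ∑_{1 ≤ n ≤ y} μ(n) log²(y/n) / n` (the sum of
Hardy–Wright (22.14.10)–(22.14.12)). [cite: HardyWright2008, §22.14 (22.14.10)] -/
def moebiusLogSqSum (y : ℝ) : ℝ :=
  ∑ k ∈ Finset.Icc 1 ⌊y⌋₊, (μ k : ℝ) / k * Real.log (y / k) ^ 2

/-- Unfolding `R₂`. [cite: HardyWright2008, §22.14 (22.14.10)] -/
theorem moebiusLogSqSum_def (y : ℝ) :
    moebiusLogSqSum y = ∑ k ∈ Finset.Icc 1 ⌊y⌋₊, (μ k : ℝ) / k * Real.log (y / k) ^ 2 := rfl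

/-- The crude bound `|R₂(y)| ≤ y log² y` for `y ≥ 1`. [folklore] -/
private theorem abs_moebiusLogSqSum_le {y : ℝ} (hy : 1 ≤ y) :
    |moebiusLogSqSum y| ≤ y * Real.log y ^ 2 := by
  unfold moebiusLogSqSum
  have hy0 : 0 < y := by linarith
  calc |∑ k ∈ Finset.Icc 1 ⌊y⌋₊, (μ k : ℝ) / k * Real.log (y / k) ^ 2|
      ≤ ∑ k ∈ Finset.Icc 1 ⌊y⌋₊, |(μ k : ℝ) / k * Real.log (y / k) ^ 2| :=
        Finset.abs_sum_le_sum_abs _ _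
    _ ≤ ∑ k ∈ Finset.Icc 1 ⌊y⌋₊, Real.log y ^ 2 := Finset.sum_le_sum fun k hk => by
        have hk1 : (1 : ℝ) ≤ k := by exact_mod_cast (Finset.mem_Icc.1 hk).1
        have hky : (k : ℝ) ≤ y := (Nat.cast_le.2 (Finset.mem_Icc.1 hk).2).trans (Nat.floor_le hy0.le)
        have hlog0 : 0 ≤ Real.log (y / k) := Real.log_nonneg ((one_le_div (by linarith)).2 hky)
        have hlog1 : Real.log (y / k) ≤ Real.log y := by
          rw [Real.log_div hy0.ne' (by linarith)]
          linarith [Real.log_nonneg hk1]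
        rw [abs_mul, abs_of_nonneg (sq_nonneg (Real.log (y / k)))]
        calc |(μ k : ℝ) / k| * Real.log (y / k) ^ 2 ≤ 1 * Real.log (y / k) ^ 2 :=
              mul_le_mul_of_nonneg_right (abs_moebius_div_le_one k) (sq_nonneg _)
          _ ≤ Real.log y ^ 2 := by
              rw [one_mul]; exact pow_le_pow_left₀ hlog0 hlog1 2
    _ = ⌊y⌋₊ * Real.log y ^ 2 := by simp
    _ ≤ y * Real.log y ^ 2 := mul_le_mul_of_nonneg_right (Nat.floor_le hy0.le) (sq_nonneg _)

/-! ### Abel summation: `R₂(y) = 2 ∫_1^y (log y − log t) m(t) dt/t` -/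

/-- **`R₂(y) = 2∫_1^y (log y − log t) m(t) dt/t`** for `y ≥ 1` (partial summation with
`f(t) = (log y − log t)²`, `f(y) = 0`, `f'(t) = −2(log y − log t)/t`; Hardy–Wright (22.5.2)).
[cite: HardyWright2008, §22.5 (22.5.2)] -/
theorem moebiusLogSqSum_eq_integral {y : ℝ} (hy : 1 ≤ y) :
    moebiusLogSqSum y =
      2 * ∫ t in Set.Ioc 1 y, (Real.log y - Real.log t) * (moebiusHarmonic t / t) := by
  have hy0 : 0 < y := by linarith
  -- Abel summation with `f(t) = (log y - log t)²`, `c(k) = μ(k)/k` on `[1, y]`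
  set f : ℝ → ℝ := fun t => (Real.log y - Real.log t) * (Real.log y - Real.log t) with hf
  have hf_has : ∀ t : ℝ, 0 < t →
      HasDerivAt f (-(2 * (Real.log y - Real.log t) * t⁻¹)) t := by
    intro t ht
    have hd : HasDerivAt (fun t => Real.log y - Real.log t) (0 - t⁻¹) t :=
      (hasDerivAt_const t _).sub (Real.hasDerivAt_log ht.ne')
    refine (hd.fun_mul hd).congr_deriv ?_
    ring
  have hf_diff : ∀ t ∈ Set.Icc (1 : ℝ) y, DifferentiableAt ℝ f t := fun t ht =>
    (hf_has t (by linarith [ht.1])).differentiableAt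
  have hderiv : ∀ t : ℝ, 0 < t → deriv f t = -(2 * (Real.log y - Real.log t) * t⁻¹) :=
    fun t ht => (hf_has t ht).deriv
  have hg_cont : ContinuousOn (fun t : ℝ => -(2 * (Real.log y - Real.log t) * t⁻¹))
      (Set.Icc (1 : ℝ) y) := by
    refine ContinuousOn.neg (ContinuousOn.mul (ContinuousOn.mul continuousOn_const
      (ContinuousOn.sub continuousOn_const (Real.continuousOn_log.mono ?_)))
      (ContinuousOn.inv₀ continuousOn_id ?_))
    · intro t ht; exact (by simpa using (by linarith [ht.1] : t ≠ 0))
    · intro t ht; exact (by linarith [ht.1] : t ≠ 0)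
  have hf_int : IntegrableOn (deriv f) (Set.Icc (1 : ℝ) y) := by
    refine IntegrableOn.congr_fun (hg_cont.integrableOn_Icc) (fun t ht => ?_) measurableSet_Icc
    exact (hderiv t (by linarith [ht.1])).symm
  have h := sum_mul_eq_sub_sub_integral_mul (fun k => (μ k : ℝ) / k) zero_le_one hy hf_diff hf_int
  rw [Nat.floor_one] at h
  have h01 : ∑ k ∈ Finset.Icc 0 1, (μ k : ℝ) / k = 1 := by
    rw [show Finset.Icc 0 1 = {0, 1} from rfl, Finset.sum_pair (by norm_num)]
    simp
  have hfy : f y = 0 := by simp [hf]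
  have hf1 : f 1 = Real.log y ^ 2 := by simp [hf]; ring
  rw [h01, hfy, hf1, zero_mul, zero_sub, mul_one] at h
  -- the partial sums `∑_{0 ≤ k ≤ ⌊t⌋} μ(k)/k` are `m(t)`
  have hS : ∀ t : ℝ, ∑ k ∈ Finset.Icc 0 ⌊t⌋₊, (μ k : ℝ) / k = moebiusHarmonic t := by
    intro t
    rw [moebiusHarmonic, Finset.Icc_eq_cons_Ioc (Nat.zero_le _), Finset.sum_cons]
    simp only [ArithmeticFunction.map_zero, Int.cast_zero, Nat.cast_zero, div_zero, zero_add]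
    rfl
  simp_rw [hS] at h
  have hint : ∫ t in Set.Ioc 1 y, deriv f t * moebiusHarmonic t =
      -(2 * ∫ t in Set.Ioc 1 y, (Real.log y - Real.log t) * (moebiusHarmonic t / t)) := by
    rw [← integral_const_mul, ← integral_neg]
    refine setIntegral_congr_fun measurableSet_Ioc fun t ht => ?_
    rw [hderiv t (by linarith [ht.1])]
    simp only [div_eq_mul_inv]
    ring
  rw [hint] at h
  -- `R₂(y) = f(1) c(1) + ∑_{1 < k ≤ y} f(k) c(k)`
  have hsplit : moebiusLogSqSum y =
      Real.log y ^ 2 + ∑ k ∈ Finset.Ioc 1 ⌊y⌋₊, f k * ((μ k : ℝ) / k) := by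
    rw [moebiusLogSqSum,
      Finset.Icc_eq_cons_Ioc (Nat.one_le_iff_ne_zero.mpr (Nat.floor_pos.mpr hy).ne'),
      Finset.sum_cons, ArithmeticFunction.moebius_apply_one]
    simp only [Int.cast_one, Nat.cast_one, div_one, one_mul]
    congr 1
    refine Finset.sum_congr rfl fun k hk => ?_
    have hk0 : (0 : ℝ) < k := by
      have : 1 < k := (Finset.mem_Ioc.1 hk).1
      exact_mod_cast (by omega : 0 < k)
    rw [hf, Real.log_div hy0.ne' hk0.ne']
    ring
  rw [hsplit, h]
  ring

/-! ### Integrability of `m(t) log t / t` on `(1, ∞)` -/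

section FromBound

variable {c₀ C₀ : ℝ}

/-- Pointwise domination of `|log t · m(t)/t|` on `(1, ∞)` by
`12 t^{−3/2} + C₀ (24/(c₀/2)⁴ + 1) exp(−(c₀/2)√log t)/t`
(`log t ≤ 2√t`, `|m| ≤ t` on `(1,2]`; `log t · e^{−(c₀/2)√log t} ≤ 24/(c₀/2)⁴ + 1` beyond).
[folklore] -/
private theorem abs_log_mul_moebiusHarmonic_div_le (hc₀ : 0 < c₀) (hC₀ : 0 ≤ C₀)
    (hmb : ∀ x : ℝ, 2 ≤ x → |moebiusHarmonic x| ≤ C₀ * Real.exp (-(c₀ * Real.sqrt (Real.log x))))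
    {t : ℝ} (ht : 1 < t) :
    |Real.log t * (moebiusHarmonic t / t)| ≤
      12 * t ^ (-(3 / 2 : ℝ)) +
        C₀ * (24 / (c₀ / 2) ^ 4 + 1) * (Real.exp (-(c₀ / 2 * Real.sqrt (Real.log t))) / t) := by
  have ht0 : 0 < t := by linarith
  have hlog0 : 0 ≤ Real.log t := Real.log_nonneg ht.le
  have hK0 : 0 ≤ 24 / (c₀ / 2) ^ 4 + 1 := by positivity
  have hA : 0 ≤ 12 * t ^ (-(3 / 2 : ℝ)) := by positivity
  have hB : 0 ≤ C₀ * (24 / (c₀ / 2) ^ 4 + 1) *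
      (Real.exp (-(c₀ / 2 * Real.sqrt (Real.log t))) / t) := by positivity
  rw [abs_mul, abs_of_nonneg hlog0, abs_div, abs_of_pos ht0]
  rcases le_or_gt t 2 with h2 | h2
  · -- `1 < t ≤ 2`: `|m(t)| ≤ t`, `log t ≤ 2√t`, so `log t |m|/t ≤ log t ≤ 2 t^{1/2} ≤ 12 t^{-3/2}`
    have hm : |moebiusHarmonic t| ≤ t := abs_moebiusHarmonic_le ht0.le
    have h1 : Real.log t * (|moebiusHarmonic t| / t) ≤ Real.log t := by
      have : |moebiusHarmonic t| / t ≤ 1 := by rw [div_le_one ht0]; exact hm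
      calc Real.log t * (|moebiusHarmonic t| / t) ≤ Real.log t * 1 :=
            mul_le_mul_of_nonneg_left this hlog0
        _ = Real.log t := mul_one _
    have h3 : Real.log t ≤ 12 * t ^ (-(3 / 2 : ℝ)) := by
      -- `log t ≤ t - 1 ≤ 1` and `t^{-3/2} ≥ 2^{-3/2} ≥ 1/4` on `(1, 2]`
      have hl1 : Real.log t ≤ 1 := by
        have := Real.log_le_sub_one_of_pos ht0; linarith
      have hp : (2 : ℝ) ^ (-(3 / 2 : ℝ)) ≤ t ^ (-(3 / 2 : ℝ)) :=
        Real.rpow_le_rpow_of_nonpos ht0 h2 (by norm_num)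
      have hp2 : (1 / 4 : ℝ) ≤ (2 : ℝ) ^ (-(3 / 2 : ℝ)) := by
        rw [Real.rpow_neg (by norm_num), show (1 / 4 : ℝ) = (4 : ℝ)⁻¹ by norm_num]
        refine inv_anti₀ (by positivity) ?_
        calc (2 : ℝ) ^ (3 / 2 : ℝ) ≤ (2 : ℝ) ^ (2 : ℝ) :=
              Real.rpow_le_rpow_of_exponent_le (by norm_num) (by norm_num)
          _ = 4 := by norm_num
      linarith
    linarith [h1.trans h3]
  · -- `t > 2`: the bound on `m` and `log t · e^{-(c₀/2)√log t} ≤ 24/(c₀/2)⁴ + 1`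
    have hm := hmb t h2.le
    have hsplit : Real.exp (-(c₀ * Real.sqrt (Real.log t))) =
        Real.exp (-(c₀ / 2 * Real.sqrt (Real.log t))) *
          Real.exp (-(c₀ / 2 * Real.sqrt (Real.log t))) := by
      rw [← Real.exp_add]; ring_nf
    have hK := log_mul_exp_neg_mul_sqrt_le (half_pos hc₀) ht.le
    calc Real.log t * (|moebiusHarmonic t| / t)
        ≤ Real.log t * (C₀ * Real.exp (-(c₀ * Real.sqrt (Real.log t))) / t) :=
          mul_le_mul_of_nonneg_left (div_le_div_of_nonneg_right hm ht0.le) hlog0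
      _ = C₀ * (Real.log t * Real.exp (-(c₀ / 2 * Real.sqrt (Real.log t)))) *
            (Real.exp (-(c₀ / 2 * Real.sqrt (Real.log t))) / t) := by
          rw [hsplit]; ring
      _ ≤ C₀ * (24 / (c₀ / 2) ^ 4 + 1) * (Real.exp (-(c₀ / 2 * Real.sqrt (Real.log t))) / t) :=
          mul_le_mul_of_nonneg_right (mul_le_mul_of_nonneg_left hK hC₀) (by positivity)
      _ ≤ _ := le_add_of_nonneg_left hA

/-- **`log t · m(t)/t` is integrable on `(1, ∞)`** under the bound `|m(x)| ≤ C₀ exp(−c₀√log x)`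
(`x ≥ 2`). [folklore] -/
private theorem integrableOn_log_mul_moebiusHarmonic_div_of_bound (hc₀ : 0 < c₀) (hC₀ : 0 ≤ C₀)
    (hmb : ∀ x : ℝ, 2 ≤ x → |moebiusHarmonic x| ≤ C₀ * Real.exp (-(c₀ * Real.sqrt (Real.log x)))) :
    IntegrableOn (fun t : ℝ => Real.log t * (moebiusHarmonic t / t)) (Set.Ioi 1) volume := by
  have hmeas : Measurable fun t : ℝ => Real.log t * (moebiusHarmonic t / t) :=
    Real.measurable_log.mul (measurable_moebiusHarmonic.div measurable_id)
  have h1 : IntegrableOn (fun t : ℝ => 12 * t ^ (-(3 / 2 : ℝ))) (Set.Ioi 1) volume :=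
    (integrableOn_Ioi_rpow_of_lt (by norm_num : (-(3 / 2 : ℝ)) < -1) zero_lt_one).const_mul 12
  have h2 : IntegrableOn (fun t : ℝ => C₀ * (24 / (c₀ / 2) ^ 4 + 1) *
      (Real.exp (-(c₀ / 2 * Real.sqrt (Real.log t))) / t)) (Set.Ioi 1) volume :=
    (MoebiusSum.integrableOn_exp_neg_mul_sqrt_log_div (half_pos hc₀)).const_mul _
  refine Integrable.mono' (h1.add h2) hmeas.aestronglyMeasurable ?_
  refine ae_restrict_of_forall_mem measurableSet_Ioi fun t ht => ?_
  rw [Real.norm_eq_abs]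
  exact abs_log_mul_moebiusHarmonic_div_le hc₀ hC₀ hmb ht

end FromBound

/-- **`log t · m(t)/t` is integrable on `(1, ∞)`**, unconditionally (de la Vallée-Poussin rate for
`m`). [cite: MontgomeryVaughan2007, Theorem 6.9 (6.12)] -/
theorem integrableOn_log_mul_moebiusHarmonic_div :
    IntegrableOn (fun t : ℝ => Real.log t * (moebiusHarmonic t / t)) (Set.Ioi 1) volume := by
  obtain ⟨c₀, hc₀, C₀, hC₀, hmb⟩ := exists_abs_moebiusHarmonic_le
  exact integrableOn_log_mul_moebiusHarmonic_div_of_bound hc₀ hC₀ hmb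

/-! ### `R₂(y) = 2 log y + O(1)` -/

/-- **`R₂(y) − 2 log y = −2∫_1^y m(t) log t dt/t − 2 log y ∫_y^∞ m(t) dt/t`** for `y ≥ 1`
(`∫_1^∞ m(t) dt/t = 1`). [folklore] -/
private theorem moebiusLogSqSum_sub_eq {y : ℝ} (hy : 1 ≤ y) :
    moebiusLogSqSum y - 2 * Real.log y =
      -(2 * ∫ t in Set.Ioc 1 y, Real.log t * (moebiusHarmonic t / t)) -
        2 * Real.log y * ∫ t in Set.Ioi y, moebiusHarmonic t / t := by
  obtain ⟨c₀, hc₀, C₀, hC₀, hmb⟩ := exists_abs_moebiusHarmonic_le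
  have hLint := integrableOn_moebiusHarmonic_div hc₀ hC₀ hmb
  have hJint := integrableOn_log_mul_moebiusHarmonic_div_of_bound hc₀ hC₀ hmb
  have hone := integral_moebiusHarmonic_div_eq_one_of_bound hc₀ hC₀ hmb
  -- `∫_1^∞ = ∫_1^y + ∫_y^∞`
  have hunion : Set.Ioc 1 y ∪ Set.Ioi y = Set.Ioi 1 := Set.Ioc_union_Ioi_eq_Ioi hy
  have hdisj : Disjoint (Set.Ioc 1 y) (Set.Ioi y) := fun s hs1 hs2 t ht =>
    absurd (lt_of_lt_of_le (Set.mem_Ioi.mp (hs2 ht)) (Set.mem_Ioc.mp (hs1 ht)).2) (lt_irrefl _)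
  have hsum := setIntegral_union hdisj measurableSet_Ioi (hLint.mono_set Set.Ioc_subset_Ioi_self)
    (hLint.mono_set (Set.Ioi_subset_Ioi hy))
  rw [hunion, hone] at hsum
  -- linearity on `(1, y]`
  have hlin : ∫ t in Set.Ioc 1 y, (Real.log y - Real.log t) * (moebiusHarmonic t / t) =
      Real.log y * (∫ t in Set.Ioc 1 y, moebiusHarmonic t / t) -
        ∫ t in Set.Ioc 1 y, Real.log t * (moebiusHarmonic t / t) := by
    rw [← integral_const_mul, ← integral_sub ((hLint.mono_set Set.Ioc_subset_Ioi_self).const_mul _)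
      (hJint.mono_set Set.Ioc_subset_Ioi_self)]
    refine setIntegral_congr_fun measurableSet_Ioc fun t _ => ?_
    ring
  rw [moebiusLogSqSum_eq_integral hy, hlin]
  have : ∫ t in Set.Ioc 1 y, moebiusHarmonic t / t = 1 - ∫ t in Set.Ioi y, moebiusHarmonic t / t := by
    linarith
  rw [this]
  ring

/-- **`R₂(y) = 2 log y + O(1)`** (Hardy–Wright §22.14, (22.14.10)–(22.14.12):
`Σ_{d ≤ x} μ(d)/d {log²(x/d) − γ²} = 2 log x + O(1)`, with `Σ_{d ≤ x} μ(d)/d = O(1)`, Thm. 424):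
there is `K` with `|∑_{n ≤ y} μ(n) log²(y/n)/n − 2 log y| ≤ K` for every `y ≥ 1`. (Proved there
elementarily, as the core of Selberg's theorem; here read off the de la Vallée-Poussin rate
`m(t) ≪ e^{−c√log t}`: `|∫_1^y m log t dt/t| ≤ ∫_1^∞ |m| log t dt/t < ∞` and
`log y · |∫_y^∞ m dt/t| ≪ log y · e^{−(c/2)√log y} ≪ 1`.)
[cite: HardyWright2008, §22.14 (22.14.10)–(22.14.12)] -/
theorem exists_abs_moebiusLogSqSum_sub_two_mul_log_le :
    ∃ K : ℝ, 0 ≤ K ∧ ∀ y : ℝ, 1 ≤ y → |moebiusLogSqSum y - 2 * Real.log y| ≤ K := by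
  obtain ⟨c₀, hc₀, C₀, hC₀, hmb⟩ := exists_abs_moebiusHarmonic_le
  have hJint := integrableOn_log_mul_moebiusHarmonic_div_of_bound hc₀ hC₀ hmb
  -- the two constants
  set J : ℝ := ∫ t in Set.Ioi 1, |Real.log t * (moebiusHarmonic t / t)| with hJ
  have hJ0 : 0 ≤ J := integral_nonneg fun t => abs_nonneg _
  set KT : ℝ := ∫ t in Set.Ioi 1, Real.exp (-(c₀ / 2 * Real.sqrt (Real.log t))) / t with hKT
  have hKT0 : 0 ≤ KT := setIntegral_nonneg measurableSet_Ioi fun t ht =>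
    div_nonneg (Real.exp_pos _).le (zero_le_one.trans ht.le)
  set L : ℝ := 24 / (c₀ / 2) ^ 4 + 1 with hL
  have hL0 : 0 ≤ L := by positivity
  refine ⟨2 * J + 2 * (C₀ * KT * L) + 4, by positivity, fun y hy => ?_⟩
  have hy0 : 0 < y := by linarith
  rcases lt_or_ge y 2 with hy2 | hy2
  · -- `1 ≤ y < 2`: crude bounds `|R₂(y)| ≤ y log² y ≤ 2`, `2 log y ≤ 2`
    have hl : Real.log y ≤ 1 := by
      have := Real.log_le_sub_one_of_pos hy0; linarith
    have hl0 : 0 ≤ Real.log y := Real.log_nonneg hy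
    have h1 : |moebiusLogSqSum y| ≤ 2 := by
      refine (abs_moebiusLogSqSum_le hy).trans ?_
      have : Real.log y ^ 2 ≤ 1 := by nlinarith
      nlinarith
    have h2 : |2 * Real.log y| ≤ 2 := by rw [abs_of_nonneg (by positivity)]; linarith
    calc |moebiusLogSqSum y - 2 * Real.log y| ≤ |moebiusLogSqSum y| + |2 * Real.log y| :=
          abs_sub _ _
      _ ≤ 2 + 2 := add_le_add h1 h2
      _ ≤ 2 * J + 2 * (C₀ * KT * L) + 4 := by
          have : 0 ≤ C₀ * KT * L := by positivity
          linarith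
  · -- `y ≥ 2`: the identity and the two estimates
    have hlogy : 0 ≤ Real.log y := Real.log_nonneg hy
    rw [moebiusLogSqSum_sub_eq hy]
    have hA : |∫ t in Set.Ioc 1 y, Real.log t * (moebiusHarmonic t / t)| ≤ J := by
      calc |∫ t in Set.Ioc 1 y, Real.log t * (moebiusHarmonic t / t)|
          ≤ ∫ t in Set.Ioc 1 y, |Real.log t * (moebiusHarmonic t / t)| := abs_integral_le_integral_abs
        _ ≤ J := setIntegral_mono_set hJint.abs (ae_of_all _ fun t => abs_nonneg _)
            (ae_of_all _ Set.Ioc_subset_Ioi_self)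
    have hB : |∫ t in Set.Ioi y, moebiusHarmonic t / t| ≤
        C₀ * KT * Real.exp (-(c₀ / 2 * Real.sqrt (Real.log y))) := by
      calc |∫ t in Set.Ioi y, moebiusHarmonic t / t| ≤ ∫ t in Set.Ioi y, |moebiusHarmonic t / t| :=
            abs_integral_le_integral_abs
        _ ≤ C₀ * KT * Real.exp (-(c₀ / 2 * Real.sqrt (Real.log y))) :=
            integral_Ioi_abs_moebiusHarmonic_div_le hc₀ hC₀ hmb hy2
    have hK := log_mul_exp_neg_mul_sqrt_le (half_pos hc₀) hy
    have hB' : |2 * Real.log y * ∫ t in Set.Ioi y, moebiusHarmonic t / t| ≤ 2 * (C₀ * KT * L) := by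
      rw [abs_mul, abs_of_nonneg (by positivity : (0 : ℝ) ≤ 2 * Real.log y)]
      calc 2 * Real.log y * |∫ t in Set.Ioi y, moebiusHarmonic t / t|
          ≤ 2 * Real.log y * (C₀ * KT * Real.exp (-(c₀ / 2 * Real.sqrt (Real.log y)))) :=
            mul_le_mul_of_nonneg_left hB (by positivity)
        _ = 2 * (C₀ * KT) * (Real.log y * Real.exp (-(c₀ / 2 * Real.sqrt (Real.log y)))) := by
            ring
        _ ≤ 2 * (C₀ * KT) * L :=
            mul_le_mul_of_nonneg_left hK (by positivity)
        _ = 2 * (C₀ * KT * L) := by ring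
    calc |-(2 * ∫ t in Set.Ioc 1 y, Real.log t * (moebiusHarmonic t / t)) -
          2 * Real.log y * ∫ t in Set.Ioi y, moebiusHarmonic t / t|
        ≤ |-(2 * ∫ t in Set.Ioc 1 y, Real.log t * (moebiusHarmonic t / t))| +
            |2 * Real.log y * ∫ t in Set.Ioi y, moebiusHarmonic t / t| := abs_sub _ _
      _ ≤ 2 * J + 2 * (C₀ * KT * L) := by
          refine add_le_add ?_ hB'
          rw [abs_neg, abs_mul, abs_of_pos (by norm_num : (0 : ℝ) < 2)]
          exact mul_le_mul_of_nonneg_left hA (by norm_num)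
      _ ≤ 2 * J + 2 * (C₀ * KT * L) + 4 := by linarith

/-- **`R₂(N) − 2 log N` is bounded along the integers** (the form used by discrete convolutions).
[cite: HardyWright2008, §22.14 (22.14.10)–(22.14.12)] -/
theorem exists_abs_moebiusLogSqSum_nat_sub_le :
    ∃ K : ℝ, 0 ≤ K ∧ ∀ N : ℕ, 1 ≤ N →
      |∑ k ∈ Finset.Icc 1 N, (μ k : ℝ) / k * Real.log ((N : ℝ) / k) ^ 2 - 2 * Real.log N| ≤ K := by
  obtain ⟨K, hK0, hK⟩ := exists_abs_moebiusLogSqSum_sub_two_mul_log_le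
  refine ⟨K, hK0, fun N hN => ?_⟩
  have h := hK N (by exact_mod_cast hN)
  rwa [moebiusLogSqSum, Nat.floor_natCast] at h

end MoebiusLogSum

end Literature.NumberTheory.LFunctions

end
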